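import Literature.NumberTheory.EllipticCurves.BhargavaShankarTrivialClass
import HarnessLib

/-!
# Bhargava–Shankar, Lemma 5.10: `f_P ∼ f_Q` iff `Q − P ∈ 2E(K)` — the image of `C_{f_P}(K)` in
# `E(K)` is the coset `P + 2E(K)`

Topic `Literature/NumberTheory/EllipticCurves`; sequel to `BhargavaShankarSolubleOrbits.lean` (the
`2`-covering map `(x,y,z) ↦ (g₄/(12z²), g₆/(8z³))` and the normal forms `f_P`, `f_O`) and
`BhargavaShankarTrivialClass.lean` (`f_P ∼ f_O ↔ P ∈ 2E(K)`).

Source: M. Bhargava, A. Shankar, Ann. of Math. (2) 181 (2015) 191–242, Lemma 5.10 of the held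
arXiv text `arXiv:1006.1002v2` (= Thm 3.2 of the published version): injectivity and
well-definedness of `Q_E : E(K)/2E(K) → {K-classes of quartics with invariants I, J}`. With the
explicit representatives `Q_E(P) = [f_P]` this is the statement proved here
(`BinaryQuartic.pgl2Equiv_quarticOfPoint_iff`): **for `K`-points `P`, `Q` of `E_{I,J}`,
`f_P` and `f_Q` are `PGL₂(K)`-equivalent iff `Q = P + 2R` for some `R ∈ E_{I,J}(K)`** (field of
characteristic `0`, `4I³ − J² ≠ 0`). Equivalently (Cremona 2001, Prop. 4.3 (4)): the image of
`C_{f_P}(K)` under the `2`-covering map is exactly the coset `P + 2E(K)`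
(`exists_covering_eq_add_add`, `exists_point_covering_eq`).

## The argument (explicit version of Cremona 2001, Prop. 4.3 (1), (4), (5))

For `P = (ξ, η)` and a point `p = (x, 1, z)` of `C_{f_P} : z² = f_P(x, 1)` put
`ρ(p) = (X, W) = (2z + 2x² − ξ/2, 4xz + 4x³ − 3ξx + η)` (`BinaryQuartic.torsorX`,
`BinaryQuartic.torsorY`). Then:

1. `ρ(p) ∈ E_{I,J}(K)`; more precisely `W² − (X³ − (I/3)X − J/27) = 4(f_P(x,1) − z²)(X − ξ)`
   identically (`torsor_defect`), so that `ρ` is the isomorphism `C_{f_P} ≅ E` "`p ↦ p − p₀`"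
   (Cremona 2001, Prop. 4.3 (5)), with inverse `(u,v) ↦ (s, 1, z)`,
   `s = (v − η)/(2(u − ξ))`, `z = (u − ξ)/2 − s² + 3ξ/4` off `u = ξ`.
2. `P`, `ρ(p)`, `ρ(p̄)` are collinear, `p̄ = (x, 1, −z)`, on the line of slope `2x` through `P`;
   hence `P + ρ(p) + ρ(p̄) = O` (`add_add_torsor_eq_zero`).
3. The covering map is `π(p) = ρ(p) − ρ(p̄)` (`covering_eq_torsor_sub`; the chord through `ρ(p)`
   and `−ρ(p̄)` has slope `(4x³ − 3ξx + η)/(2z)`, and `x(π(p)) − ξ = W(p)W(p̄)/(4z²)`).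
4. Hence `π(p) = P + 2ρ(p)` (`covering_eq_add_add_torsor`): the image of `C_{f_P}(K)` lies in
   `P + 2E(K)` (the points with `y = 0` map to `±P`), and conversely `P + 2R` (`≠ O`) is the
   image of `ρ⁻¹(R)` (`exists_point_covering_eq`).
5. Finally `f_P ∼ f_Q` iff `Q = π(p)` for some `p ∈ C_{f_P}(K)` with `z ≠ 0` (normal forms and the
   invariance of `π`, companion file), whence the theorem.

## References

* M. Bhargava, A. Shankar, Ann. of Math. (2) 181 (2015) 191–242, Lemma 5.10 (arXiv:1006.1002v2
  numbering; Thm 3.2 of the published version). [cite: BhargavaShankarAnnals2015, Lemma 5.10 (arXiv:1006.1002v2 numbering)]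
* J. E. Cremona, *Classical invariants and 2-descent on elliptic curves*, J. Symbolic Comput. 31
  (2001) 71–87, Prop. 4.2, Prop. 4.3. [cite: Cremona2001, Prop. 4.3]

## Design

Characteristic `0`, points as triples, `E_{I,J}(K)` = Mathlib's `(curveOfInvariants K I J).toAffine.Point`,
as in the companion files. `2R` is written `R + R`.
-/

noncomputable section

open scoped Classical
open Matrix

namespace Literature.NumberTheory.EllipticCurves

namespace BinaryQuartic

variable {K : Type*} [Field K] [CharZero K]

/-! ## The trivialisation `ρ : C_{f_P} → E_{I,J}` -/

omit [CharZero K] in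
/-- `x`-coordinate `X = 2z + 2x² − ξ/2` of `ρ(p) = "p − p₀" ∈ E_{I,J}` for the point `p = (x, 1, z)`
of `C_{f_P}`, `P = (ξ, η)` (the isomorphism `C ≅ E` of Cremona 2001, Prop. 4.3 (5), made explicit
for the normal form `f_P`). [cite: Cremona2001, Prop. 4.3] -/
def torsorX (ξ x z : K) : K :=
  2 * z + 2 * x ^ 2 - ξ / 2

omit [CharZero K] in
/-- `y`-coordinate `W = 4xz + 4x³ − 3ξx + η` of `ρ(p) ∈ E_{I,J}` for `p = (x, 1, z) ∈ C_{f_P}`.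
[cite: Cremona2001, Prop. 4.3] -/
def torsorY (ξ η x z : K) : K :=
  4 * x * z + 4 * x ^ 3 - 3 * ξ * x + η

/-- **The defect identity**: for `P = (ξ, η) ∈ E_{I,J}` and arbitrary `x, z`,
`W² − (X³ − (I/3)X − J/27) = 4(f_P(x,1) − z²)(X − ξ)` with `(X, W) = ρ(x, z)`. In particular
`ρ(p) ∈ E_{I,J}` for `p ∈ C_{f_P}`, and conversely `ρ(x,z) ∈ E_{I,J}` with `X ≠ ξ` forces
`(x, 1, z) ∈ C_{f_P}`. [cite: Cremona2001, Prop. 4.3] -/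
theorem torsor_defect {I J ξ η : K} (hP : (curveOfInvariants K I J).toAffine.Equation ξ η)
    (x z : K) :
    torsorY ξ η x z ^ 2 - (torsorX ξ x z ^ 3 - I / 3 * torsorX ξ x z - J / 27) =
      4 * ((quarticOfPoint I ξ η).eval x 1 - z ^ 2) * (torsorX ξ x z - ξ) := by
  rw [curveOfInvariants_equation_iff] at hP
  have hJ : J = 27 * ξ ^ 3 - 9 * I * ξ - 27 * η ^ 2 := by linear_combination 27 * hP
  rw [hJ, eval_quarticOfPoint_one]
  simp only [torsorX, torsorY]
  ring

/-- `ρ(p) ∈ E_{I,J}` for `p = (x, 1, z) ∈ C_{f_P}`. [cite: Cremona2001, Prop. 4.3] -/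
theorem equation_torsor {I J ξ η : K} (hP : (curveOfInvariants K I J).toAffine.Equation ξ η)
    {x z : K} (hz : z ^ 2 = (quarticOfPoint I ξ η).eval x 1) :
    (curveOfInvariants K I J).toAffine.Equation (torsorX ξ x z) (torsorY ξ η x z) := by
  rw [curveOfInvariants_equation_iff]
  have h := torsor_defect hP x z
  rw [hz, sub_self, mul_zero, zero_mul] at h
  exact (sub_eq_zero.mp h)

/-- `ρ(p)` is a (nonsingular) point of `E_{I,J}(K)`. [cite: Cremona2001, Prop. 4.3] -/
theorem nonsingular_torsor {I J ξ η : K} (hΔ : 4 * I ^ 3 - J ^ 2 ≠ 0)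
    (hP : (curveOfInvariants K I J).toAffine.Equation ξ η)
    {x z : K} (hz : z ^ 2 = (quarticOfPoint I ξ η).eval x 1) :
    (curveOfInvariants K I J).toAffine.Nonsingular (torsorX ξ x z) (torsorY ξ η x z) :=
  curveOfInvariants_nonsingular_of_equation hΔ (equation_torsor hP hz)

omit [CharZero K] in
/-- The conjugate point `p̄ = (x, 1, −z)`: `X(p̄) = X(p) − 4z`. [folklore] -/
theorem torsorX_neg (ξ x z : K) : torsorX ξ x (-z) = torsorX ξ x z - 4 * z := by
  simp only [torsorX]; ring

omit [CharZero K] in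
/-- The conjugate point `p̄ = (x, 1, −z)`: `W(p̄) = W(p) − 8xz`. [folklore] -/
theorem torsorY_neg (ξ η x z : K) : torsorY ξ η x (-z) = torsorY ξ η x z - 8 * x * z := by
  simp only [torsorY]; ring

/-- Collinearity of `P`, `ρ(p)`, `ρ(p̄)`: `η − W = 2x(ξ − X)` (the line of slope `2x` through `P`). [folklore] -/
theorem torsor_collinear (ξ η x z : K) : η - torsorY ξ η x z = 2 * x * (ξ - torsorX ξ x z) := by
  simp only [torsorX, torsorY]; ring

/-- **`P + ρ(p) + ρ(p̄) = O`**: the three points are the intersection of `E_{I,J}` with the line of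
slope `2x` through `P` (`p = (x, 1, z) ∈ C_{f_P}`, `p̄ = (x, 1, −z)`; no condition on `z`).
[cite: Cremona2001, Prop. 4.3] -/
theorem add_add_torsor_eq_zero {I J ξ η : K} (hΔ : 4 * I ^ 3 - J ^ 2 ≠ 0)
    (hP : (curveOfInvariants K I J).toAffine.Nonsingular ξ η) {x z : K}
    (hz : z ^ 2 = (quarticOfPoint I ξ η).eval x 1)
    (hR : (curveOfInvariants K I J).toAffine.Nonsingular (torsorX ξ x z) (torsorY ξ η x z))
    (hR' : (curveOfInvariants K I J).toAffine.Nonsingular (torsorX ξ x (-z)) (torsorY ξ η x (-z))) :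
    (.some _ _ hP : (curveOfInvariants K I J).toAffine.Point) + .some _ _ hR + .some _ _ hR' = 0 := by
  have hPE : η ^ 2 = ξ ^ 3 - I / 3 * ξ - J / 27 := (curveOfInvariants_equation_iff I J ξ η).mp hP.1
  have hzI : I = 12 * (z ^ 2 - x ^ 4 + 3 / 2 * ξ * x ^ 2 - η * x + 3 / 16 * ξ ^ 2) := by
    rw [eval_quarticOfPoint_one] at hz; linear_combination (-12 : K) * hz
  by_cases hX : ξ = torsorX ξ x z
  · -- `P = ρ(p)`: the line is the tangent at `P`
    have hW : η = torsorY ξ η x z := by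
      have h := torsor_collinear ξ η x z
      rw [← hX, sub_self, mul_zero, sub_eq_zero] at h
      exact h
    have hz' : z = 3 / 4 * ξ - x ^ 2 := by
      simp only [torsorX] at hX; linear_combination (-(1 / 2) : K) * hX
    have hI : I = 9 * ξ ^ 2 - 12 * η * x := by rw [hzI, hz']; ring
    have hJ : J = 27 * ξ ^ 3 - 9 * I * ξ - 27 * η ^ 2 := by linear_combination 27 * hPE
    have hη : η ≠ 0 := by
      intro hη
      apply hΔ
      rw [hJ, hI, hη]
      ring
    have hPR : (.some _ _ hR : (curveOfInvariants K I J).toAffine.Point) = .some _ _ hP := by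
      simp only [WeierstrassCurve.Affine.Point.some.injEq]
      exact ⟨hX.symm, hW.symm⟩
    rw [hPR]
    have hy : η ≠ (curveOfInvariants K I J).toAffine.negY ξ η := by
      rw [curveOfInvariants_negY]
      intro h; apply hη; linear_combination (1 / 2 : K) * h
    have h2v : (2 * η : K) ≠ 0 := mul_ne_zero two_ne_zero hη
    have hden : η - (curveOfInvariants K I J).toAffine.negY ξ η = 2 * η := by
      rw [curveOfInvariants_negY]; ring
    have hs : (curveOfInvariants K I J).toAffine.slope ξ ξ η η = 2 * x := by
      rw [WeierstrassCurve.Affine.slope_of_Y_ne rfl hy, hden, div_eq_iff h2v]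
      simp only [curveOfInvariants]
      rw [hI]; ring
    rw [WeierstrassCurve.Affine.Point.add_self_of_Y_ne hy]
    refine WeierstrassCurve.Affine.Point.add_of_Y_eq ?_ ?_
    · rw [hs]
      simp only [WeierstrassCurve.Affine.addX, curveOfInvariants, torsorX_neg, hz']
      simp only [torsorX]
      ring
    · rw [hs, curveOfInvariants_negY]
      simp only [WeierstrassCurve.Affine.addY, WeierstrassCurve.Affine.negAddY,
        WeierstrassCurve.Affine.addX, WeierstrassCurve.Affine.negY, curveOfInvariants,
        torsorY_neg, hz']
      simp only [torsorY]
      ring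
  · -- generic case: the chord through `P` and `ρ(p)` has slope `2x`
    have hs : (curveOfInvariants K I J).toAffine.slope ξ (torsorX ξ x z) η (torsorY ξ η x z) =
        2 * x := by
      rw [WeierstrassCurve.Affine.slope_of_X_ne hX, div_eq_iff (sub_ne_zero.mpr hX)]
      exact torsor_collinear ξ η x z
    rw [WeierstrassCurve.Affine.Point.add_of_X_ne hX]
    refine WeierstrassCurve.Affine.Point.add_of_Y_eq ?_ ?_
    · rw [hs]
      simp only [WeierstrassCurve.Affine.addX, curveOfInvariants, torsorX_neg]
      simp only [torsorX]
      ring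
    · rw [hs, curveOfInvariants_negY]
      simp only [WeierstrassCurve.Affine.addY, WeierstrassCurve.Affine.negAddY,
        WeierstrassCurve.Affine.addX, WeierstrassCurve.Affine.negY, curveOfInvariants,
        torsorY_neg]
      simp only [torsorX, torsorY]
      ring

/-! ## The covering map is `π(p) = ρ(p) − ρ(p̄) = P + 2ρ(p)` -/

/-- The covering map at `p = (x, 1, z) ∈ C_{f_P}`, `z ≠ 0`, lands on `E_{I,J}` (the companion
file's `nonsingular_covering`, with the invariants `(I(f_P), J(f_P)) = (I, J)` substituted).
[cite: Cremona2001, Prop. 4.2] -/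
theorem nonsingular_covering_quarticOfPoint {I J ξ η : K} (hΔ : 4 * I ^ 3 - J ^ 2 ≠ 0)
    (hP : (curveOfInvariants K I J).toAffine.Equation ξ η) {x y z : K}
    (hz : z ^ 2 = (quarticOfPoint I ξ η).eval x y) (hz0 : z ≠ 0) :
    (curveOfInvariants K I J).toAffine.Nonsingular (coveringX (quarticOfPoint I ξ η) x y z)
      (coveringY (quarticOfPoint I ξ η) x y z) := by
  have h := nonsingular_covering (disc_quarticOfPoint_ne_zero hΔ hP) hz hz0
  rwa [I_quarticOfPoint, (J_quarticOfPoint_eq_iff I J ξ η).mpr hP] at h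

/-- `x(π(p)) = w₀²/(4z²) − 2X + 4z` with `w₀ = 4x³ − 3ξx + η` (the `x`-coordinate of the chord sum
`ρ(p) + (−ρ(p̄))`, whose slope is `w₀/(2z)`); equivalently `g₄(f_P)(x,1) = 3w₀² − 48x²z² + 12ξz²`.
[folklore] -/
theorem coveringX_quarticOfPoint_eq {I ξ η x z : K} (hz : z ^ 2 = (quarticOfPoint I ξ η).eval x 1)
    (hz0 : z ≠ 0) :
    coveringX (quarticOfPoint I ξ η) x 1 z =
      ((4 * x ^ 3 - 3 * ξ * x + η) / (2 * z)) ^ 2 - torsorX ξ x z - (torsorX ξ x z - 4 * z) := by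
  have hzI : I = 12 * (z ^ 2 - x ^ 4 + 3 / 2 * ξ * x ^ 2 - η * x + 3 / 16 * ξ ^ 2) := by
    rw [eval_quarticOfPoint_one] at hz; linear_combination (-12 : K) * hz
  simp only [coveringX, g4, eval, quarticOfPoint, torsorX]
  rw [hzI]
  field_simp
  ring

/-- `y(π(p)) = (w₀/(2z))·(X − x(π(p))) − W` (the `y`-coordinate of the chord sum `ρ(p) + (−ρ(p̄))`).
[folklore] -/
theorem coveringY_quarticOfPoint_eq {I ξ η x z : K} (hz : z ^ 2 = (quarticOfPoint I ξ η).eval x 1)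
    (hz0 : z ≠ 0) :
    coveringY (quarticOfPoint I ξ η) x 1 z =
      (4 * x ^ 3 - 3 * ξ * x + η) / (2 * z) *
          (torsorX ξ x z - coveringX (quarticOfPoint I ξ η) x 1 z) - torsorY ξ η x z := by
  rw [coveringX_quarticOfPoint_eq hz hz0]
  have hzI : I = 12 * (z ^ 2 - x ^ 4 + 3 / 2 * ξ * x ^ 2 - η * x + 3 / 16 * ξ ^ 2) := by
    rw [eval_quarticOfPoint_one] at hz; linear_combination (-12 : K) * hz
  simp only [coveringY, g6, quarticOfPoint, torsorX, torsorY]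
  rw [hzI]
  field_simp
  ring

/-- **`π(p) = ρ(p) − ρ(p̄)`** for `p = (x, 1, z) ∈ C_{f_P}`, `z ≠ 0` (the `x`-coordinates of `ρ(p)`,
`ρ(p̄)` differ by `4z ≠ 0`, so this is one chord addition). [cite: Cremona2001, Prop. 4.3] -/
theorem covering_eq_torsor_sub {I J ξ η : K}
    {x z : K} (hz : z ^ 2 = (quarticOfPoint I ξ η).eval x 1) (hz0 : z ≠ 0)
    (hQ : (curveOfInvariants K I J).toAffine.Nonsingular (coveringX (quarticOfPoint I ξ η) x 1 z)
      (coveringY (quarticOfPoint I ξ η) x 1 z))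
    (hR : (curveOfInvariants K I J).toAffine.Nonsingular (torsorX ξ x z) (torsorY ξ η x z))
    (hR' : (curveOfInvariants K I J).toAffine.Nonsingular (torsorX ξ x (-z)) (torsorY ξ η x (-z))) :
    (.some _ _ hQ : (curveOfInvariants K I J).toAffine.Point) = .some _ _ hR - .some _ _ hR' := by
  have h4z : (4 * z : K) ≠ 0 := mul_ne_zero (by norm_num) hz0
  have h2z : (2 * z : K) ≠ 0 := mul_ne_zero two_ne_zero hz0
  have hXX : torsorX ξ x z ≠ torsorX ξ x (-z) := by
    rw [torsorX_neg]; intro h; apply h4z; linear_combination h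
  rw [sub_eq_add_neg, WeierstrassCurve.Affine.Point.neg_some,
    WeierstrassCurve.Affine.Point.add_of_X_ne hXX]
  have hs : (curveOfInvariants K I J).toAffine.slope (torsorX ξ x z) (torsorX ξ x (-z))
      (torsorY ξ η x z) ((curveOfInvariants K I J).toAffine.negY (torsorX ξ x (-z))
        (torsorY ξ η x (-z))) = (4 * x ^ 3 - 3 * ξ * x + η) / (2 * z) := by
    rw [WeierstrassCurve.Affine.slope_of_X_ne hXX, curveOfInvariants_negY, torsorX_neg, torsorY_neg,
      div_eq_div_iff (by intro h; apply h4z; linear_combination h) h2z]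
    simp only [torsorY]
    ring
  simp only [WeierstrassCurve.Affine.Point.some.injEq]
  refine ⟨?_, ?_⟩
  · rw [coveringX_quarticOfPoint_eq hz hz0, hs]
    simp only [WeierstrassCurve.Affine.addX, curveOfInvariants, torsorX_neg]
    ring
  · rw [coveringY_quarticOfPoint_eq hz hz0, coveringX_quarticOfPoint_eq hz hz0, hs]
    simp only [WeierstrassCurve.Affine.addY, WeierstrassCurve.Affine.negAddY,
      WeierstrassCurve.Affine.addX, WeierstrassCurve.Affine.negY, curveOfInvariants, torsorX_neg]
    ring

/-- **`π(p) = P + 2ρ(p)`** for `p = (x, 1, z) ∈ C_{f_P}(K)`, `z ≠ 0`: the covering map is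
"multiplication by `2`, translated by `P`" in the trivialisation `ρ` (Cremona 2001, Prop. 4.3 (1):
`ξ = [2] ∘ θ`). [cite: Cremona2001, Prop. 4.3] -/
theorem covering_eq_add_add_torsor {I J ξ η : K} (hΔ : 4 * I ^ 3 - J ^ 2 ≠ 0)
    (hP : (curveOfInvariants K I J).toAffine.Nonsingular ξ η)
    {x z : K} (hz : z ^ 2 = (quarticOfPoint I ξ η).eval x 1) (hz0 : z ≠ 0)
    (hQ : (curveOfInvariants K I J).toAffine.Nonsingular (coveringX (quarticOfPoint I ξ η) x 1 z)
      (coveringY (quarticOfPoint I ξ η) x 1 z))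
    (hR : (curveOfInvariants K I J).toAffine.Nonsingular (torsorX ξ x z) (torsorY ξ η x z)) :
    (.some _ _ hQ : (curveOfInvariants K I J).toAffine.Point) =
      .some _ _ hP + (.some _ _ hR + .some _ _ hR) := by
  have hz' : (-z) ^ 2 = (quarticOfPoint I ξ η).eval x 1 := by rw [neg_sq, hz]
  have hR' := nonsingular_torsor hΔ hP.1 hz'
  have h3 := add_add_torsor_eq_zero hΔ hP hz hR hR'
  have hneg : -(.some _ _ hR' : (curveOfInvariants K I J).toAffine.Point) = .some _ _ hP + .some _ _ hR :=
    neg_eq_of_add_eq_zero_left h3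
  rw [covering_eq_torsor_sub hz hz0 hQ hR hR', sub_eq_add_neg, hneg]
  abel

/-! ## The image of `C_{f_P}(K)` is `P + 2E(K)` -/

/-- The points of `C_{f_P}` with `y = 0` are `(t, 0, ±t²)` and map to `±P`: `x`-coordinate. [folklore] -/
theorem coveringX_quarticOfPoint_zero {I ξ η t z : K} (ht : t ≠ 0)
    (hz : z ^ 2 = (quarticOfPoint I ξ η).eval t 0) : coveringX (quarticOfPoint I ξ η) t 0 z = ξ := by
  have hz' : z ^ 2 = t ^ 4 := by rw [hz]; simp [eval, quarticOfPoint]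
  have hz0 : z ≠ 0 := by
    intro h; rw [h] at hz'; exact pow_ne_zero 4 ht (by simpa using hz'.symm)
  simp only [coveringX, g4, eval, quarticOfPoint]
  rw [div_eq_iff (mul_ne_zero (by norm_num) (pow_ne_zero 2 hz0)), hz']
  ring

/-- The points of `C_{f_P}` with `y = 0` map to `±P`: `y`-coordinate (`z = ±t²`). [folklore] -/
theorem coveringY_quarticOfPoint_zero {I ξ η t z : K} (ht : t ≠ 0)
    (hz : z ^ 2 = (quarticOfPoint I ξ η).eval t 0) :
    coveringY (quarticOfPoint I ξ η) t 0 z = η ∨ coveringY (quarticOfPoint I ξ η) t 0 z = -η := by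
  have hz' : z ^ 2 = (t ^ 2) ^ 2 := by rw [hz]; simp only [eval, quarticOfPoint]; ring
  rcases sq_eq_sq_iff_eq_or_eq_neg.mp hz' with h | h
  · left
    have hz0 : z ≠ 0 := by rw [h]; exact pow_ne_zero 2 ht
    simp only [coveringY, g6, quarticOfPoint]
    rw [div_eq_iff (mul_ne_zero (by norm_num) (pow_ne_zero 3 hz0)), h]
    ring
  · right
    have hz0 : z ≠ 0 := by rw [h]; exact neg_ne_zero.mpr (pow_ne_zero 2 ht)
    simp only [coveringY, g6, quarticOfPoint]
    rw [div_eq_iff (mul_ne_zero (by norm_num) (pow_ne_zero 3 hz0)), h]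
    ring

/-- **The image of `C_{f_P}(K)` lies in `P + 2E(K)`**: every point `(x, y, z)` of `C_{f_P}` with
`z ≠ 0` maps to `P + 2R` for some `R ∈ E_{I,J}(K)` (namely `R = ρ(x/y, z/y²)` if `y ≠ 0`, and
`R = O` or `−P` for the two points with `y = 0`). [cite: Cremona2001, Prop. 4.3] -/
theorem exists_covering_eq_add_add {I J ξ η : K} (hΔ : 4 * I ^ 3 - J ^ 2 ≠ 0)
    (hP : (curveOfInvariants K I J).toAffine.Nonsingular ξ η) {x y z : K} (hxy : x ≠ 0 ∨ y ≠ 0)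
    (hz : z ^ 2 = (quarticOfPoint I ξ η).eval x y) (hz0 : z ≠ 0) :
    ∃ R : (curveOfInvariants K I J).toAffine.Point,
      (.some _ _ (nonsingular_covering_quarticOfPoint hΔ hP.1 hz hz0) :
          (curveOfInvariants K I J).toAffine.Point) = .some _ _ hP + (R + R) := by
  by_cases hy : y = 0
  · subst hy
    have hx : x ≠ 0 := hxy.resolve_right (not_not.mpr rfl)
    have hX := coveringX_quarticOfPoint_zero hx hz
    rcases coveringY_quarticOfPoint_zero hx hz with hY | hY
    · refine ⟨0, ?_⟩
      rw [add_zero, add_zero]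
      simp only [WeierstrassCurve.Affine.Point.some.injEq]
      exact ⟨hX, hY⟩
    · refine ⟨-.some _ _ hP, ?_⟩
      have h2 : (.some _ _ hP : (curveOfInvariants K I J).toAffine.Point) + (-.some _ _ hP + -.some _ _ hP) =
          -.some _ _ hP := by abel
      rw [h2, WeierstrassCurve.Affine.Point.neg_some]
      simp only [WeierstrassCurve.Affine.Point.some.injEq]
      exact ⟨hX, by rw [hY, curveOfInvariants_negY]⟩
  · -- rescale to `y = 1`
    set x' := y⁻¹ * x with hx'
    set z' := (y⁻¹) ^ 2 * z with hz'
    have hz'0 : z' ≠ 0 := mul_ne_zero (pow_ne_zero 2 (inv_ne_zero hy)) hz0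
    have hz'1 : z' ^ 2 = (quarticOfPoint I ξ η).eval x' 1 := by
      have h1 : (y⁻¹ * y : K) = 1 := inv_mul_cancel₀ hy
      rw [hz', hx', ← h1, eval_smul_smul, ← hz]
      ring
    have hXe : coveringX (quarticOfPoint I ξ η) x y z = coveringX (quarticOfPoint I ξ η) x' 1 z' := by
      rw [hx', hz', ← coveringX_smul (quarticOfPoint I ξ η) (inv_ne_zero hy) x y z, inv_mul_cancel₀ hy]
    have hYe : coveringY (quarticOfPoint I ξ η) x y z = coveringY (quarticOfPoint I ξ η) x' 1 z' := by
      rw [hx', hz', ← coveringY_smul (quarticOfPoint I ξ η) (inv_ne_zero hy) x y z, inv_mul_cancel₀ hy]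
    have hQ' := nonsingular_covering_quarticOfPoint hΔ hP.1 hz'1 hz'0
    have hR := nonsingular_torsor hΔ hP.1 hz'1
    refine ⟨.some _ _ hR, ?_⟩
    rw [← covering_eq_add_add_torsor hΔ hP hz'1 hz'0 hQ' hR]
    simp only [WeierstrassCurve.Affine.Point.some.injEq]
    exact ⟨hXe, hYe⟩

/-- **Every point of `P + 2E(K)` other than `O` is in the image of `C_{f_P}(K)`**: given
`R ∈ E_{I,J}(K)` with `P + 2R ≠ O` there is a point `(x, y, z)` of `C_{f_P}` with `z ≠ 0` mapping
to `P + 2R` (the point `ρ⁻¹(R)`, or `(1, 0, ∓1)` when `R = O, −P`). [cite: Cremona2001, Prop. 4.3] -/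
theorem exists_point_covering_eq {I J ξ η : K} (hΔ : 4 * I ^ 3 - J ^ 2 ≠ 0)
    (hP : (curveOfInvariants K I J).toAffine.Nonsingular ξ η)
    (R : (curveOfInvariants K I J).toAffine.Point)
    (hne : (.some _ _ hP : (curveOfInvariants K I J).toAffine.Point) + (R + R) ≠ 0) :
    ∃ x y z : K, ∃ _ : x ≠ 0 ∨ y ≠ 0, ∃ hz : z ^ 2 = (quarticOfPoint I ξ η).eval x y,
      ∃ hz0 : z ≠ 0,
        (.some _ _ (nonsingular_covering_quarticOfPoint hΔ hP.1 hz hz0) :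
            (curveOfInvariants K I J).toAffine.Point) = .some _ _ hP + (R + R) := by
  have hPE : η ^ 2 = ξ ^ 3 - I / 3 * ξ - J / 27 := (curveOfInvariants_equation_iff I J ξ η).mp hP.1
  -- the base points `(1, 0, ±1)`
  have hbase : ∀ s : K, s ^ 2 = 1 → s ^ 2 = (quarticOfPoint I ξ η).eval 1 0 := fun s hs ↦ by
    rw [hs]; simp [eval, quarticOfPoint]
  rcases R with _ | ⟨u, v, hR⟩
  · -- `R = O`: the base point `p₀ = (1, 0, 1)` maps to `P`
    refine ⟨1, 0, 1, Or.inl one_ne_zero, hbase 1 (one_pow 2), one_ne_zero, ?_⟩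
    rw [← WeierstrassCurve.Affine.Point.zero_def, add_zero, add_zero]
    simp only [WeierstrassCurve.Affine.Point.some.injEq]
    exact ⟨coveringX_quarticOfPoint I ξ η, coveringY_quarticOfPoint I ξ η⟩
  · have hRE : v ^ 2 = u ^ 3 - I / 3 * u - J / 27 := (curveOfInvariants_equation_iff I J u v).mp hR.1
    -- a point `p = (x, 1, z)` of `C_{f_P}` with `ρ(p) = R` does the job
    have key : ∀ x z : K, z ^ 2 = (quarticOfPoint I ξ η).eval x 1 → torsorX ξ x z = u →
        torsorY ξ η x z = v →
        ∃ x y z : K, ∃ _ : x ≠ 0 ∨ y ≠ 0, ∃ hz : z ^ 2 = (quarticOfPoint I ξ η).eval x y,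
          ∃ hz0 : z ≠ 0,
            (.some _ _ (nonsingular_covering_quarticOfPoint hΔ hP.1 hz hz0) :
                (curveOfInvariants K I J).toAffine.Point) =
              .some _ _ hP + (.some _ _ hR + .some _ _ hR) := by
      intro x z hz hX hW
      have hRρ : (.some _ _ hR : (curveOfInvariants K I J).toAffine.Point) =
          .some _ _ (nonsingular_torsor hΔ hP.1 hz) := by
        simp only [WeierstrassCurve.Affine.Point.some.injEq]; exact ⟨hX.symm, hW.symm⟩
      have hz0 : z ≠ 0 := by
        intro hz0
        subst hz0
        apply hne
        have hz' : (-0 : K) ^ 2 = (quarticOfPoint I ξ η).eval x 1 := by rw [neg_zero]; exact hz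
        have h3 := add_add_torsor_eq_zero hΔ hP hz (nonsingular_torsor hΔ hP.1 hz)
          (nonsingular_torsor hΔ hP.1 hz')
        have hρρ : (.some _ _ (nonsingular_torsor hΔ hP.1 hz') : (curveOfInvariants K I J).toAffine.Point) =
            .some _ _ (nonsingular_torsor hΔ hP.1 hz) := by
          simp only [WeierstrassCurve.Affine.Point.some.injEq]
          exact ⟨by rw [neg_zero], by rw [neg_zero]⟩
        rw [hρρ, ← hRρ, add_assoc] at h3
        exact h3
      refine ⟨x, 1, z, Or.inr one_ne_zero, hz, hz0, ?_⟩
      rw [hRρ]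
      exact covering_eq_add_add_torsor hΔ hP hz hz0 _ _
    by_cases hvη : u = ξ ∧ v = -η
    · -- `R = −P`: the point `(1, 0, −1)` maps to `−P = P + 2R`
      obtain ⟨rfl, rfl⟩ := hvη
      refine ⟨1, 0, -1, Or.inl one_ne_zero, hbase (-1) (by ring), by norm_num, ?_⟩
      have hRP : (.some _ _ hR : (curveOfInvariants K I J).toAffine.Point) = -.some _ _ hP := by
        rw [WeierstrassCurve.Affine.Point.neg_some]
        simp only [curveOfInvariants_negY]
      have h2 : (.some _ _ hP : (curveOfInvariants K I J).toAffine.Point) + (-.some _ _ hP + -.some _ _ hP) =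
          -.some _ _ hP := by abel
      rw [hRP, h2, WeierstrassCurve.Affine.Point.neg_some]
      simp only [WeierstrassCurve.Affine.Point.some.injEq]
      refine ⟨?_, ?_⟩
      · have h := coveringX_smul (quarticOfPoint I u η) (neg_ne_zero.mpr (one_ne_zero (α := K))) 1 0 (-1)
        rw [show ((-1 : K) * 1) = -1 by ring, show ((-1 : K) * 0) = 0 by ring,
          show ((-1 : K) ^ 2 * -1) = -1 by ring] at h
        simp only [coveringX, g4_eval_one_zero, quarticOfPoint]
        field_simp
        ring
      · rw [curveOfInvariants_negY]
        simp only [coveringY, g6_one_zero, quarticOfPoint]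
        field_simp
        ring
    · by_cases hu : u = ξ
      · -- `R = P` (`η ≠ 0`): the point with `ρ(p) = P` is `(λ/2, 1, 3ξ/4 − λ²/4)`, `λ` the tangent slope
        have hv : v = η := by
          have h2 : v ^ 2 = η ^ 2 := by rw [hRE, hPE, hu]
          rcases sq_eq_sq_iff_eq_or_eq_neg.mp h2 with h | h
          · exact h
          · exact absurd ⟨hu, h⟩ hvη
        subst hu hv
        have hη : v ≠ 0 := by
          intro h; apply hvη; exact ⟨rfl, by rw [h, neg_zero]⟩
        set x : K := (3 * u ^ 2 - I / 3) / (4 * v) with hx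
        set z : K := 3 / 4 * u - x ^ 2 with hz
        have h4v : (4 * v : K) ≠ 0 := mul_ne_zero (by norm_num) hη
        have hxv : x * (4 * v) = 3 * u ^ 2 - I / 3 := by rw [hx, div_mul_cancel₀ _ h4v]
        refine key x z ?_ ?_ ?_
        · rw [eval_quarticOfPoint_one, hz]
          linear_combination (-(1 / 4) : K) * hxv
        · simp only [torsorX]; rw [hz]; ring
        · simp only [torsorY]; rw [hz]; ring
      · -- generic `R`: `p = ρ⁻¹(R) = (s, 1, z)`, `s = (v − η)/(2(u − ξ))`, `z = (u − ξ)/2 − s² + 3ξ/4`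
        have huξ : (u - ξ : K) ≠ 0 := sub_ne_zero.mpr hu
        set s : K := (v - η) / (2 * (u - ξ)) with hs
        set z : K := (u - ξ) / 2 - s ^ 2 + 3 / 4 * ξ with hz
        have hX : torsorX ξ s z = u := by simp only [torsorX]; rw [hz]; ring
        have hW : torsorY ξ η s z = v := by
          have h2 : s * (2 * (u - ξ)) = v - η := by
            rw [hs, div_mul_cancel₀ _ (mul_ne_zero two_ne_zero huξ)]
          simp only [torsorY]; rw [hz]; linear_combination h2
        have hzC : z ^ 2 = (quarticOfPoint I ξ η).eval s 1 := by
          have h := torsor_defect hP.1 s z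
          rw [hX, hW, hRE, sub_self] at h
          have h' : (quarticOfPoint I ξ η).eval s 1 - z ^ 2 = 0 := by
            rcases mul_eq_zero.mp h.symm with h1 | h1
            · rcases mul_eq_zero.mp h1 with h2 | h2
              · norm_num at h2
              · exact h2
            · exact absurd h1 huξ
          exact (sub_eq_zero.mp h').symm
        exact key s z hzC hX hW

/-! ## `f_P ∼ f_Q` iff `Q` is in the image of `C_{f_P}(K)` iff `Q ∈ P + 2E(K)` -/

/-- `f_P ∼ f_Q` iff `Q = π(p)` for a point `p` of `C_{f_P}` with `z ≠ 0`: (`⇒`) if `γ · f_P = f_Q`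
then `p = ((1,0)γ, det γ)` is such a point (the base point of `C_{f_Q}` pulled back), (`⇐`) the
normal form `pgl2Equiv_quarticOfPoint_covering`. [cite: BhargavaShankarAnnals2015, Lemma 5.10 (arXiv:1006.1002v2 numbering)] -/
theorem pgl2Equiv_quarticOfPoint_iff_exists_point {I ξ η ξ' η' : K} :
    PGL2Equiv (quarticOfPoint I ξ η) (quarticOfPoint I ξ' η') ↔
      ∃ x y z : K, (x ≠ 0 ∨ y ≠ 0) ∧ z ^ 2 = (quarticOfPoint I ξ η).eval x y ∧ z ≠ 0 ∧
        coveringX (quarticOfPoint I ξ η) x y z = ξ' ∧ coveringY (quarticOfPoint I ξ η) x y z = η' := by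
  constructor
  · rintro ⟨γ, hγ, h⟩
    change quarticOfPoint I ξ' η' = twist γ (quarticOfPoint I ξ η) at h
    have ha := congrArg BinaryQuartic.a h
    rw [quarticOfPoint_a, twist_a_eq] at ha
    have hz : γ.det ^ 2 = (quarticOfPoint I ξ η).eval (γ 0 0) (γ 0 1) := by
      have h2 : (γ.det ^ 2 : K) ≠ 0 := pow_ne_zero 2 hγ
      field_simp at ha
      linear_combination ha
    have hrow : γ 0 0 ≠ 0 ∨ γ 0 1 ≠ 0 := by
      by_contra hcon
      push Not at hcon
      apply hγ
      rw [Matrix.det_fin_two, hcon.1, hcon.2]; ring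
    refine ⟨γ 0 0, γ 0 1, γ.det, hrow, hz, hγ, ?_, ?_⟩
    · rw [← coveringX_twist_one_zero hγ, ← h, coveringX_quarticOfPoint]
    · rw [← coveringY_twist_one_zero hγ, ← h, coveringY_quarticOfPoint]
  · rintro ⟨x, y, z, hxy, hz, hz0, hX, hY⟩
    have h := pgl2Equiv_quarticOfPoint_covering (quarticOfPoint I ξ η) hxy hz hz0
    rwa [I_quarticOfPoint, hX, hY] at h

/-- **Bhargava–Shankar, Lemma 5.10 (well-definedness and injectivity of `Q_E` on non-identity
classes): for `K`-points `P = (ξ, η)`, `Q = (ξ', η')` of `E_{I,J}`, `f_P ∼ f_Q` iff `Q = P + 2R` for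
some `R ∈ E_{I,J}(K)`** (characteristic `0`, `4I³ ≠ J²`; Cremona 2001, Prop. 4.3 (4): the image of
`C_{f_P}(K)` is the coset `P + 2E(K)`). [cite: BhargavaShankarAnnals2015, Lemma 5.10 (arXiv:1006.1002v2 numbering)] -/
theorem pgl2Equiv_quarticOfPoint_iff {I J ξ η ξ' η' : K} (hΔ : 4 * I ^ 3 - J ^ 2 ≠ 0)
    (hP : (curveOfInvariants K I J).toAffine.Nonsingular ξ η)
    (hQ : (curveOfInvariants K I J).toAffine.Nonsingular ξ' η') :
    PGL2Equiv (quarticOfPoint I ξ η) (quarticOfPoint I ξ' η') ↔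
      ∃ R : (curveOfInvariants K I J).toAffine.Point,
        (.some _ _ hQ : (curveOfInvariants K I J).toAffine.Point) = .some _ _ hP + (R + R) := by
  rw [pgl2Equiv_quarticOfPoint_iff_exists_point]
  constructor
  · rintro ⟨x, y, z, hxy, hz, hz0, hX, hY⟩
    obtain ⟨R, hR⟩ := exists_covering_eq_add_add hΔ hP hxy hz hz0
    refine ⟨R, ?_⟩
    rw [← hR]
    simp only [WeierstrassCurve.Affine.Point.some.injEq]
    exact ⟨hX.symm, hY.symm⟩
  · rintro ⟨R, hR⟩
    have hne : (.some _ _ hP : (curveOfInvariants K I J).toAffine.Point) + (R + R) ≠ 0 := by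
      rw [← hR]; exact WeierstrassCurve.Affine.Point.some_ne_zero _
    obtain ⟨x, y, z, hxy, hz, hz0, h⟩ := exists_point_covering_eq hΔ hP R hne
    rw [← hR] at h
    simp only [WeierstrassCurve.Affine.Point.some.injEq] at h
    exact ⟨x, y, z, hxy, hz, hz0, h.1, h.2⟩

end BinaryQuartic

end Literature.NumberTheory.EllipticCurves

end
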